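import Summits.QuantumFields.QCD.Theorems.QuarksAsStableActionCriticalLineDiamagnetismRectFreqOpDefs

/-!
# Route B infrastructure for stub `stub_heavyFrequencyGain` of line `Sketch` — gauge invariance of the 2D frequency
determinant on RECTANGULAR two-tori
(crux `Summit.QuantumFields.QCD.Theses.QuarksAsStableAction.CriticalLineDiamagnetism`, item stmt-QuantumFields-9734,
static route for odd tori, Route B of the heavy-frequency gain)

A site-wise colour rotation `g : ℤ/L₁ × ℤ/L₂ → U(3)` acts on the index space `(ℤ/L₁ × ℤ/L₂) × colour × spin` of the
rectangular frequency operator `freqOpR γ A m ω₀ ω₁` (`…RectFreqOpDefs`) through the block-diagonal, spin-trivial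
*colour lift* `G(u)((x,a,α),(y,b,β)) = [x = y][α = β] u x a b`.  We decompose `freqOpR` into its on-site part (a spin
lift, colour-trivial) and its four seam-signed hops (`freqOpR_eq_hops`), and conjugate each piece:
the on-site part commutes with colour lifts (`colourLift_conj_spinLift`), a forward hop `x → e x` reading the colour
matrix `U x` becomes the hop reading `u x · U x · v (e x)` (`colourLift_conj_hop`), a backward one reading `U y` becomes
`u (e y) · U y · v y` (`colourLift_conj_hop'`).  With `u = g`, `v = g⋆` this is exactly the frequency operator of the
gauge transformed field `A^g(x, μ) = g x · A(x, μ) · g(x + e_μ)⁻¹` (`colourLift_conj_freqOpR`; the seam signs are scalars),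
whence `det freqOpR γ A^g = det freqOpR γ A` (`det_colourLift_conj`, registered as `gaugeDet`).
References: Montvay–Münster, *Quantum Fields on a Lattice* §5.1.1 (gauge transformations of link variables and of the
fermion matrix); folklore.  Pure theorem file (no `def`s): the lifts are written as explicit `Matrix.of` matrices.
-/

noncomputable section

open scoped BigOperators Matrix ComplexConjugate
open Finset
open Literature.MathematicalPhysics.QuantumLattice Literature.MathematicalPhysics.QuantumFieldTheory
  Literature.Probability.LatticeModels

namespace Summit.QuantumFields.QCD.Cruxes.CriticalLineDiamagnetism.ChessboardCellGain

namespace FrequencyDiamagnetism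

open Matrix Complex

/-! ### Colour lifts `1_site-diagonal ⊗ u ⊗ 1_spin` of site-dependent colour matrices -/

section ColourLift

variable {X : Type} [Fintype X] [DecidableEq X]

/-- Left multiplication by the colour lift of `u`, entrywise. -/
theorem colourLift_mul_apply (u : X → Matrix (Fin 3) (Fin 3) ℂ)
    (M : Matrix (X × Fin 3 × Fin 4) (X × Fin 3 × Fin 4) ℂ) (p q : X × Fin 3 × Fin 4) :
    ((Matrix.of fun a b : X × Fin 3 × Fin 4 => if a.1 = b.1 ∧ a.2.2 = b.2.2 then u a.1 a.2.1 b.2.1 else 0) * M) p q =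
      ∑ c : Fin 3, u p.1 p.2.1 c * M (p.1, c, p.2.2) q := by
  -- adapted from `spinLift_mul_apply` (…StubFrequencyDiamagnetismAux1.lean)
  rw [Matrix.mul_apply, Fintype.sum_prod_type, Finset.sum_eq_single_of_mem p.1 (Finset.mem_univ _)
      fun x _ hx => by simp [Ne.symm hx],
    Fintype.sum_prod_type]
  refine Finset.sum_congr rfl fun c _ => ?_
  rw [Finset.sum_eq_single_of_mem p.2.2 (Finset.mem_univ _) fun α _ hα => by simp [Ne.symm hα]]
  simp only [Matrix.of_apply, and_self, if_true]

/-- Right multiplication by the colour lift of `v`, entrywise. -/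
theorem mul_colourLift_apply (M : Matrix (X × Fin 3 × Fin 4) (X × Fin 3 × Fin 4) ℂ)
    (v : X → Matrix (Fin 3) (Fin 3) ℂ) (p q : X × Fin 3 × Fin 4) :
    (M * Matrix.of fun a b : X × Fin 3 × Fin 4 => if a.1 = b.1 ∧ a.2.2 = b.2.2 then v a.1 a.2.1 b.2.1 else 0) p q =
      ∑ d : Fin 3, M p (q.1, d, q.2.2) * v q.1 d q.2.1 := by
  rw [Matrix.mul_apply, Fintype.sum_prod_type, Finset.sum_eq_single_of_mem q.1 (Finset.mem_univ _)
      fun x _ hx => by simp [hx],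
    Fintype.sum_prod_type]
  refine Finset.sum_congr rfl fun d _ => ?_
  rw [Finset.sum_eq_single_of_mem q.2.2 (Finset.mem_univ _) fun β _ hβ => by simp [hβ]]
  simp only [Matrix.of_apply, and_self, if_true]

/-- Colour lifts multiply as their colour matrices, site by site. -/
theorem colourLift_mul_colourLift (u v : X → Matrix (Fin 3) (Fin 3) ℂ) :
    (Matrix.of fun a b : X × Fin 3 × Fin 4 => if a.1 = b.1 ∧ a.2.2 = b.2.2 then u a.1 a.2.1 b.2.1 else 0) *
        (Matrix.of fun a b : X × Fin 3 × Fin 4 => if a.1 = b.1 ∧ a.2.2 = b.2.2 then v a.1 a.2.1 b.2.1 else 0) =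
      Matrix.of fun a b : X × Fin 3 × Fin 4 =>
        if a.1 = b.1 ∧ a.2.2 = b.2.2 then (u a.1 * v a.1) a.2.1 b.2.1 else 0 := by
  ext p q
  rw [colourLift_mul_apply]
  simp only [Matrix.of_apply, Matrix.mul_apply]
  split_ifs with h
  · rfl
  · simp

omit [Fintype X] in
/-- The colour lift of the constant `1` is `1`. -/
theorem colourLift_one :
    (Matrix.of fun a b : X × Fin 3 × Fin 4 =>
      if a.1 = b.1 ∧ a.2.2 = b.2.2 then (1 : Matrix (Fin 3) (Fin 3) ℂ) a.2.1 b.2.1 else 0) = 1 := by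
  ext ⟨x, c, α⟩ ⟨y, d, β⟩
  simp only [Matrix.of_apply, Matrix.one_apply, Prod.mk.injEq]
  by_cases hxy : x = y <;> by_cases hcd : c = d <;> by_cases hαβ : α = β <;> simp [hxy, hcd, hαβ]

/-- Conjugating by colour lifts of `u`, `v` with `u x · v x = 1` does not change the determinant. -/
theorem det_colourLift_conj (u v : X → Matrix (Fin 3) (Fin 3) ℂ) (huv : ∀ x, u x * v x = 1)
    (M : Matrix (X × Fin 3 × Fin 4) (X × Fin 3 × Fin 4) ℂ) :
    ((Matrix.of fun a b : X × Fin 3 × Fin 4 => if a.1 = b.1 ∧ a.2.2 = b.2.2 then u a.1 a.2.1 b.2.1 else 0) * M *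
        (Matrix.of fun a b : X × Fin 3 × Fin 4 => if a.1 = b.1 ∧ a.2.2 = b.2.2 then v a.1 a.2.1 b.2.1 else 0)).det =
      M.det := by
  rw [Matrix.det_mul, Matrix.det_mul, mul_comm (Matrix.det (Matrix.of _)) M.det, mul_assoc, ← Matrix.det_mul,
    colourLift_mul_colourLift]
  simp only [huv]
  rw [colourLift_one, Matrix.det_one, mul_one]

/-- **Colour lifts of `u`, `v` with `u x · v x = 1` commute past a spin lift** (the colour-trivial on-site part). -/
theorem colourLift_conj_spinLift (u v : X → Matrix (Fin 3) (Fin 3) ℂ) (huv : ∀ x, u x * v x = 1)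
    (N : Matrix (Fin 4) (Fin 4) ℂ) :
    (Matrix.of fun a b : X × Fin 3 × Fin 4 => if a.1 = b.1 ∧ a.2.2 = b.2.2 then u a.1 a.2.1 b.2.1 else 0) *
        (Matrix.of fun a b : X × Fin 3 × Fin 4 => if a.1 = b.1 ∧ a.2.1 = b.2.1 then N a.2.2 b.2.2 else 0) *
        (Matrix.of fun a b : X × Fin 3 × Fin 4 => if a.1 = b.1 ∧ a.2.2 = b.2.2 then v a.1 a.2.1 b.2.1 else 0) =
      Matrix.of fun a b : X × Fin 3 × Fin 4 => if a.1 = b.1 ∧ a.2.1 = b.2.1 then N a.2.2 b.2.2 else 0 := by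
  ext p q
  rw [mul_colourLift_apply, Matrix.of_apply]
  simp_rw [colourLift_mul_apply, Matrix.of_apply]
  by_cases h : p.1 = q.1
  · simp only [h, true_and, mul_ite, mul_zero, Finset.sum_ite_eq', Finset.mem_univ, if_true]
    have h1 := congrFun (congrFun (huv q.1) p.2.1) q.2.1
    rw [Matrix.mul_apply, Matrix.one_apply] at h1
    calc ∑ d : Fin 3, u q.1 p.2.1 d * N p.2.2 q.2.2 * v q.1 d q.2.1
        = N p.2.2 q.2.2 * ∑ d : Fin 3, u q.1 p.2.1 d * v q.1 d q.2.1 := by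
          rw [Finset.mul_sum]; exact Finset.sum_congr rfl fun d _ => by ring
      _ = _ := by rw [h1, mul_ite, mul_one, mul_zero]
  · simp only [h, false_and, if_false, mul_zero, Finset.sum_const_zero, zero_mul]

/-- **Conjugating a forward hop `x → e x` by colour lifts**: the hop reading the colour matrix `U x` (times a spin matrix
`S` and a scalar `σ x`) becomes the hop reading `u x · U x · v (e x)`. -/
theorem colourLift_conj_hop (u v : X → Matrix (Fin 3) (Fin 3) ℂ) (e : X → X) (S : Matrix (Fin 4) (Fin 4) ℂ)
    (σ : X → ℂ) (U : X → Matrix (Fin 3) (Fin 3) ℂ) :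
    (Matrix.of fun a b : X × Fin 3 × Fin 4 => if a.1 = b.1 ∧ a.2.2 = b.2.2 then u a.1 a.2.1 b.2.1 else 0) *
        (Matrix.of fun p q : X × Fin 3 × Fin 4 =>
          if q.1 = e p.1 then S p.2.2 q.2.2 * (σ p.1 * U p.1 p.2.1 q.2.1) else 0) *
        (Matrix.of fun a b : X × Fin 3 × Fin 4 => if a.1 = b.1 ∧ a.2.2 = b.2.2 then v a.1 a.2.1 b.2.1 else 0) =
      Matrix.of fun p q : X × Fin 3 × Fin 4 =>
        if q.1 = e p.1 then S p.2.2 q.2.2 * (σ p.1 * (u p.1 * U p.1 * v (e p.1)) p.2.1 q.2.1) else 0 := by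
  ext p q
  rw [mul_colourLift_apply, Matrix.of_apply]
  simp_rw [colourLift_mul_apply, Matrix.of_apply]
  by_cases h : q.1 = e p.1
  · simp only [h, if_true, Matrix.mul_apply, Finset.sum_mul, Finset.mul_sum]
    exact Finset.sum_congr rfl fun d _ => Finset.sum_congr rfl fun c _ => by ring
  · simp only [if_neg h, mul_zero, Finset.sum_const_zero, zero_mul]

/-- **Conjugating a backward hop `e y ← y` by colour lifts**: the hop reading the colour matrix `U y` becomes the hop
reading `u (e y) · U y · v y`. -/
theorem colourLift_conj_hop' (u v : X → Matrix (Fin 3) (Fin 3) ℂ) (e : X → X) (S : Matrix (Fin 4) (Fin 4) ℂ)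
    (σ : X → ℂ) (U : X → Matrix (Fin 3) (Fin 3) ℂ) :
    (Matrix.of fun a b : X × Fin 3 × Fin 4 => if a.1 = b.1 ∧ a.2.2 = b.2.2 then u a.1 a.2.1 b.2.1 else 0) *
        (Matrix.of fun p q : X × Fin 3 × Fin 4 =>
          if p.1 = e q.1 then S p.2.2 q.2.2 * (σ q.1 * U q.1 p.2.1 q.2.1) else 0) *
        (Matrix.of fun a b : X × Fin 3 × Fin 4 => if a.1 = b.1 ∧ a.2.2 = b.2.2 then v a.1 a.2.1 b.2.1 else 0) =
      Matrix.of fun p q : X × Fin 3 × Fin 4 =>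
        if p.1 = e q.1 then S p.2.2 q.2.2 * (σ q.1 * (u (e q.1) * U q.1 * v q.1) p.2.1 q.2.1) else 0 := by
  ext p q
  rw [mul_colourLift_apply, Matrix.of_apply]
  simp_rw [colourLift_mul_apply, Matrix.of_apply]
  by_cases h : p.1 = e q.1
  · simp only [h, if_true, Matrix.mul_apply, Finset.sum_mul, Finset.mul_sum]
    exact Finset.sum_congr rfl fun d _ => Finset.sum_congr rfl fun c _ => by ring
  · simp only [if_neg h, mul_zero, Finset.sum_const_zero, zero_mul]

end ColourLift

/-! ### The hop decomposition of the rectangular frequency operator -/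

/-- `freqOpR` is its colour-trivial on-site spin lift minus half the sum of its four seam-signed hops. -/
theorem freqOpR_eq_hops {L₁ L₂ : ℕ} (γ : Fin 4 → Matrix (Fin 4) (Fin 4) ℂ)
    (A : ZMod L₁ → ZMod L₂ → Fin 4 → Matrix.unitaryGroup (Fin 3) ℂ) (m ω₀ ω₁ : ℝ) :
    freqOpR γ A m ω₀ ω₁ =
      (Matrix.of fun a b : (ZMod L₁ × ZMod L₂) × Fin 3 × Fin 4 => if a.1 = b.1 ∧ a.2.1 = b.2.1 then
          (((m + 4 - Real.cos ω₀ - Real.cos ω₁ : ℝ) : ℂ) • (1 : Matrix (Fin 4) (Fin 4) ℂ) +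
            Complex.I • (((Real.sin ω₀ : ℝ) : ℂ) • γ 0 + ((Real.sin ω₁ : ℝ) : ℂ) • γ 1)) a.2.2 b.2.2 else 0) -
      (1 / 2 : ℂ) •
        ((Matrix.of fun p q : (ZMod L₁ × ZMod L₂) × Fin 3 × Fin 4 =>
            if q.1 = (fun x : ZMod L₁ × ZMod L₂ => (x.1 + 1, x.2)) p.1 then
              ((1 : Matrix (Fin 4) (Fin 4) ℂ) - γ 2) p.2.2 q.2.2 *
                ((fun x : ZMod L₁ × ZMod L₂ => if x.1 = -1 then (-1 : ℂ) else 1) p.1 *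
                  (fun x : ZMod L₁ × ZMod L₂ => (A x.1 x.2 2 : Matrix (Fin 3) (Fin 3) ℂ)) p.1 p.2.1 q.2.1)
            else 0) +
          (Matrix.of fun p q : (ZMod L₁ × ZMod L₂) × Fin 3 × Fin 4 =>
            if p.1 = (fun y : ZMod L₁ × ZMod L₂ => (y.1 + 1, y.2)) q.1 then
              ((1 : Matrix (Fin 4) (Fin 4) ℂ) + γ 2) p.2.2 q.2.2 *
                ((fun y : ZMod L₁ × ZMod L₂ => if y.1 = -1 then (-1 : ℂ) else 1) q.1 *
                  (fun y : ZMod L₁ × ZMod L₂ => star (A y.1 y.2 2 : Matrix (Fin 3) (Fin 3) ℂ)) q.1 p.2.1 q.2.1)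
            else 0) +
          (Matrix.of fun p q : (ZMod L₁ × ZMod L₂) × Fin 3 × Fin 4 =>
            if q.1 = (fun x : ZMod L₁ × ZMod L₂ => (x.1, x.2 + 1)) p.1 then
              ((1 : Matrix (Fin 4) (Fin 4) ℂ) - γ 3) p.2.2 q.2.2 *
                ((fun x : ZMod L₁ × ZMod L₂ => if x.2 = -1 then (-1 : ℂ) else 1) p.1 *
                  (fun x : ZMod L₁ × ZMod L₂ => (A x.1 x.2 3 : Matrix (Fin 3) (Fin 3) ℂ)) p.1 p.2.1 q.2.1)
            else 0) +
          (Matrix.of fun p q : (ZMod L₁ × ZMod L₂) × Fin 3 × Fin 4 =>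
            if p.1 = (fun y : ZMod L₁ × ZMod L₂ => (y.1, y.2 + 1)) q.1 then
              ((1 : Matrix (Fin 4) (Fin 4) ℂ) + γ 3) p.2.2 q.2.2 *
                ((fun y : ZMod L₁ × ZMod L₂ => if y.2 = -1 then (-1 : ℂ) else 1) q.1 *
                  (fun y : ZMod L₁ × ZMod L₂ => star (A y.1 y.2 3 : Matrix (Fin 3) (Fin 3) ℂ)) q.1 p.2.1 q.2.1)
            else 0)) := by
  ext p q
  simp only [freqOpR, Matrix.of_apply, Matrix.sub_apply, Matrix.add_apply, Matrix.smul_apply, smul_eq_mul]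

/-! ### Gauge covariance -/

/-- **Gauge covariance of the rectangular frequency operator**: conjugating `freqOpR γ A` by the colour lifts of a site-wise
rotation `u = g` and of `v = g⋆` gives the frequency operator of the gauge transformed field
`A'(x, μ) = g x · A(x, μ) · g(x + e_μ)⁻¹` (`μ = 2, 3`; the seam signs are scalars and commute with `g`).  The lifts and
the transformed field are variables with defining hypotheses (instantiated by `rfl`). -/
theorem colourLift_conj_freqOpR {L₁ L₂ : ℕ} [NeZero L₁] [NeZero L₂] (γ : Fin 4 → Matrix (Fin 4) (Fin 4) ℂ)
    (g : ZMod L₁ → ZMod L₂ → Matrix.unitaryGroup (Fin 3) ℂ)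
    (A : ZMod L₁ → ZMod L₂ → Fin 4 → Matrix.unitaryGroup (Fin 3) ℂ) (m ω₀ ω₁ : ℝ)
    (u v : ZMod L₁ × ZMod L₂ → Matrix (Fin 3) (Fin 3) ℂ)
    (A' : ZMod L₁ → ZMod L₂ → Fin 4 → Matrix.unitaryGroup (Fin 3) ℂ)
    (hu : u = fun x => (g x.1 x.2 : Matrix (Fin 3) (Fin 3) ℂ))
    (hv : v = fun x => star (g x.1 x.2 : Matrix (Fin 3) (Fin 3) ℂ))
    (hA' : A' = fun a b μ => if μ = 2 then g a b * A a b 2 * (g (a + 1) b)⁻¹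
      else if μ = 3 then g a b * A a b 3 * (g a (b + 1))⁻¹ else A a b μ) :
    (Matrix.of fun a b : (ZMod L₁ × ZMod L₂) × Fin 3 × Fin 4 =>
        if a.1 = b.1 ∧ a.2.2 = b.2.2 then u a.1 a.2.1 b.2.1 else 0) * freqOpR γ A m ω₀ ω₁ *
        (Matrix.of fun a b : (ZMod L₁ × ZMod L₂) × Fin 3 × Fin 4 =>
          if a.1 = b.1 ∧ a.2.2 = b.2.2 then v a.1 a.2.1 b.2.1 else 0) =
      freqOpR γ A' m ω₀ ω₁ := by
  have huv : ∀ x, u x * v x = 1 := fun x => by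
    rw [hu, hv]
    exact Unitary.mul_star_self_of_mem (g x.1 x.2).prop
  have hA2 : ∀ a b, A' a b 2 = g a b * A a b 2 * (g (a + 1) b)⁻¹ := fun a b => by
    rw [hA']
    exact if_pos rfl
  have hA3 : ∀ a b, A' a b 3 = g a b * A a b 3 * (g a (b + 1))⁻¹ := fun a b => by
    rw [hA']
    exact (if_neg (by decide)).trans (if_pos rfl)
  -- decompose both frequency operators into on-site part and hops, distribute, conjugate each piece
  rw [freqOpR_eq_hops γ A, freqOpR_eq_hops γ A', Matrix.mul_sub, Matrix.sub_mul, Matrix.mul_smul, Matrix.smul_mul,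
    Matrix.mul_add, Matrix.mul_add, Matrix.mul_add, Matrix.add_mul, Matrix.add_mul, Matrix.add_mul,
    colourLift_conj_spinLift u v huv,
    colourLift_conj_hop u v (fun x => (x.1 + 1, x.2)) ((1 : Matrix (Fin 4) (Fin 4) ℂ) - γ 2)
      (fun x => if x.1 = -1 then (-1 : ℂ) else 1) (fun x => (A x.1 x.2 2 : Matrix (Fin 3) (Fin 3) ℂ)),
    colourLift_conj_hop' u v (fun y => (y.1 + 1, y.2)) ((1 : Matrix (Fin 4) (Fin 4) ℂ) + γ 2)
      (fun y => if y.1 = -1 then (-1 : ℂ) else 1) (fun y => star (A y.1 y.2 2 : Matrix (Fin 3) (Fin 3) ℂ)),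
    colourLift_conj_hop u v (fun x => (x.1, x.2 + 1)) ((1 : Matrix (Fin 4) (Fin 4) ℂ) - γ 3)
      (fun x => if x.2 = -1 then (-1 : ℂ) else 1) (fun x => (A x.1 x.2 3 : Matrix (Fin 3) (Fin 3) ℂ)),
    colourLift_conj_hop' u v (fun y => (y.1, y.2 + 1)) ((1 : Matrix (Fin 4) (Fin 4) ℂ) + γ 3)
      (fun y => if y.2 = -1 then (-1 : ℂ) else 1) (fun y => star (A y.1 y.2 3 : Matrix (Fin 3) (Fin 3) ℂ))]
  -- the conjugated links are the transformed links
  subst hu hv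
  simp only [hA2, hA3, Matrix.UnitaryGroup.mul_val, Matrix.UnitaryGroup.inv_val, star_mul, star_star,
    Matrix.mul_assoc]

end FrequencyDiamagnetism

/-! ### Registered theorem -/

open FrequencyDiamagnetism in
/-- **Stub `gaugeDet`** (gauge invariance of the rectangular 2D frequency determinant): for site-wise colour rotations
`g : ℤ/L₁ → ℤ/L₂ → U(3)`, the frequency determinant of the gauge transformed field
`A^g(x, μ) = g x · A(x, μ) · g(x + e_μ)⁻¹` (`μ = 2, 3`) equals the one of `A` — `freqOpR γ A^g` is the conjugate of
`freqOpR γ A` by the (unitary, block-diagonal, spin-trivial) colour lift of `g`. -/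
theorem gaugeDet : ∀ (L₁ L₂ : ℕ) [NeZero L₁] [NeZero L₂] (g : ZMod L₁ → ZMod L₂ → Matrix.unitaryGroup (Fin 3) ℂ) (A : ZMod L₁ → ZMod L₂ → Fin 4 → Matrix.unitaryGroup (Fin 3) ℂ) (m ω₀ ω₁ : ℝ), (freqOpR euclideanGamma (fun a b μ => if μ = 2 then g a b * A a b 2 * (g (a + 1) b)⁻¹ else if μ = 3 then g a b * A a b 3 * (g a (b + 1))⁻¹ else A a b μ) m ω₀ ω₁).det = (freqOpR euclideanGamma A m ω₀ ω₁).det := by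
  intro L₁ L₂ _ _ g A m ω₀ ω₁
  have huv : ∀ x : ZMod L₁ × ZMod L₂,
      (g x.1 x.2 : Matrix (Fin 3) (Fin 3) ℂ) * star (g x.1 x.2 : Matrix (Fin 3) (Fin 3) ℂ) = 1 := fun x =>
    Unitary.mul_star_self_of_mem (g x.1 x.2).prop
  rw [← colourLift_conj_freqOpR euclideanGamma g A m ω₀ ω₁ _ _ _ rfl rfl rfl, det_colourLift_conj _ _ huv]

end Summit.QuantumFields.QCD.Cruxes.CriticalLineDiamagnetism.ChessboardCellGain

end
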